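import Literature.MathematicalPhysics.QuantumFieldTheory.Balaban1983to89.Beta.RemainderDecay190
import Literature.MathematicalPhysics.QuantumFieldTheory.Balaban1983to89.B6Lemma21TowerTorus
import Literature.MathematicalPhysics.QuantumFieldTheory.Balaban1983to89.B6Lemma21R0MultiLevelBox
import Literature.MathematicalPhysics.QuantumFieldTheory.Balaban1983to89.B9Thm37GlueTorus

/-!
# [Balaban1987RG1] p. 282 ⟵ [Balaban1984PropagatorsII] (2.61): the row-sum link `hrow` of the (190)-socket `Data190`
# of the torus remainder chain, DISCHARGED BY NAME for the two block-geometry families the tree carries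
# (`Beta.RemainderRowSum`)

HONEST FRAMING (cell rule, page 1 of everything).  Discharging `BetaPertH` makes Bałaban's UV stability UNCONDITIONAL —
a real constructive-QFT result; it is NOT the continuum limit and NOT the Clay problem.  This module discharges NOTHING
of `BetaPertH` and constructs NO object of Bałaban's.  It closes, by name, ONE object-independent link of the wall's item
(D4) (`RemainderConst` ⇐ the k-uniform remainder chain `Beta.RemainderDecay190.ChainTFac190`): the field
`Data190.hrow : ∀ n, RowSum (gn n) q.σ q.cR` (`Beta/RemainderDecay190.lean` :235) — the row sum (2.61) of [3] Lemma 2.1,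
*"sup_{y∈𝔅} Σ_{y′∈𝔅} e^{−αδ₀d(y,y′)} ≤ c₁(α)"*, at the rate σ with ONE constant c for EVERY member n of the exhausting
torus sequence — for the two families of block geometries `B6.Geometry` that exist in the tree as terms:
* the ONE-SCALE TORUS family `B6Prop22OneScaleTorus.oneScaleGeo P Mb R` (sites = the unit torus `T₁^{(K)}` of the
  tower carriers `Params`, `2L^m` sites per direction, d(y,y′) = the periodic ℓ¹ distance; [3] p. 235 *"If we have one
  scale, i.e. Λ_k = T₁^{(k)}"*), where (2.61) holds WITH THE PRINTED `c₁(α) = 12c₀(½α)^d` for every `α, δ₀` with `αδ₀ > 0`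
  and NO side condition, uniformly in the volume (`B6Lemma21TowerTorus.ineq261_oneScaleGeo`, lit-balaban p01);
* the GENUINE k-LEVEL BOX family `B6Lemma21R0MultiLevelBox.geomR0 D` (sites = the blocks 𝔅 of a nested family
  `D : Domains d ℓ M_h k P R` (2.1)–(2.2), d(y,y′) = print's (2.46) read literally, reading R0), where (2.61) holds with
  the d-ONLY REPAIRED constant `c₁″ = B6Lemma21TwoScale.c1TwoScale (d+1) δ₀ α` under print's (2.59) for `R` and
  `M = L·M_h`, uniformly in `k`, the volume `P` and the family (`…R0MultiLevelBox.lemma21R0_multiLevelBox'`, lit-balaban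
  p21; the PRINTED c₁ is refuted on towers for d ≥ 3, `B6Lemma21Counterexample`, cell GAPS G-A11-1 — hence c₁″).
In both cases the conclusion is LITERALLY the type of the field `Data190.hrow` for the corresponding `gn`, with `q.σ`
the rate and any `q.cR ≥` the family's constant: ONE constant for all tori ∕ volumes ∕ numbers of levels — the
uniformity the field demands is DISPLAYED, not assumed (§4).

WHY (owner table `HOME/b2b-balaban-beta-an4/D4-INSTANCE-LINKS.md` §3 row `hrow` ∕ §4): among the links of the (190)-socket
that do NOT wait on NODE O (Bałaban's step objects as terms), `hrow` was recorded as «`B11SectG.RowSum` typed; provable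
per geometry (kernel row-sum engines in tree)» with no hypothesis-to-field lemma NAMED; after this file the builder of the
instance instantiates `hrow` in one line once NODE O fixes WHICH geometry family carries the Sect. G block norms (the
geometry `gn n` is shared by `hrow`, `h190`, `hdist` and the block norms `bBn` ∕ `boutn` — `RemainderDecay190SectG.h190_of_sectG`
takes the same `gn n` and the same row sum as its `hrow` input).

WHAT IS KERNEL-CHECKED (0 sorry; 0 def; axioms standard; nothing imported is modified):
§1 `rowSum_of_ineq261With` ((2.61) with any constant IS the row sum at σ = αδ₀, `Iff.rfl`-level), `rowSum_mono_const`,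
   `rowSum_family_mono_const` (one larger constant serves a whole family);
§2 `rowSum_oneScaleGeo` ∕ `rowSum_oneScaleGeo_rate` (one-scale torus: printed c₁(α) at rate αδ₀, resp. c₁(σ∕δ₀) at any
   rate σ > 0), **`hrow_oneScaleGeo`** — `∀ n, RowSum (oneScaleGeo (Pn n) (Mb n) (R n)) σ cR` for every family of tower
   parameters `Pn` of dimension d (volumes `(Pn n).m`, scales `(Pn n).K`, block data `Mb n`, `R n` arbitrary) and every
   `cR ≥ c₁(σ∕δ₀)`;
§3 `rowSum_geomR0` (genuine k-level box: c₁″ at rate αδ₀ under (2.59)), **`hrow_geomR0`** — `∀ n, RowSum (geomR0 (Dn n))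
   (α*δ₀) cR` for every family `Dn n : Domains d ℓ M_h (kn n) (Pn n) R` with COMMON `ℓ, M_h, R` (so ONE condition (2.59))
   and arbitrary numbers of levels `kn n` and volumes `Pn n`, every `cR ≥ c₁″`;
§4 THE FIELD'S TYPE VERBATIM in the chain's currency `q : Consts190`: `hrow_field_oneScaleGeo`, `hrow_field_geomR0`
   (`∀ n, RowSum (gn n) q.σ q.cR` for `gn := fun n => oneScaleGeo …` resp. `fun n => geomR0 (Dn n)`).
§5 (v1.1, appended) the one-scale SITE-torus family `B9Thm34Ext.toB6 (B9Thm37GlueTorus.torusGeom Nf η L M) R H`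
   (sites `UT Nf` — the carrier of the NODE-O walk objects `B13JointWalkExpansion` ∕ `B13TermWalkData`): `rowSum_torusGeom`
   (`c₀(α)^d`, by `B9Thm37GlueTorus.torusSum_tdist1_le`), `rowSum_torusGeom_c1` (printed c₁), **`hrow_torusGeom`**, `hrow_field_torusGeom`.

WHAT THIS DOES NOT DO: it does not say WHICH geometry family is Bałaban's 𝔅 for the k-th step on the torus T_{N n} (NODE
O of the (D4) skeleton — ownerless, FROZEN by ruling (0)); it proves no multi-scale TORUS version of (2.61) beyond the two
families above (the genuine k-level family is typed on the box carrier of `B6MultiLevelBoxOperator`); it touches no other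
field of `Data190` (`h190` ∕ `dHn`: `RemainderDecay190SectG`; `hdom` ∕ `hD` ∕ θ: the (T12) dictionary CONVENTION; N1–N3:
`RemainderChainKP`).  Row D4 class UNCHANGED: typed reduction DONE, instance 0∕1, critical-path width 0 (NODE O), D4
DISCHARGE NO DATE.  NOT B12 Thm 2, NOT BetaPertH, NOT continuum, NOT Clay.  HONEST DEPENDENCY: continuum YM on T⁴ ⇐
BetaPertH ∧ nine spine estimates (0/9 proved); BetaPertH ⇐ (D1) ∧ (D4) ∧ CAP+tail; G-an2-4 gates asym, D1 and NE2/3/4.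

References: T. Bałaban, *Propagators and renormalization transformations for lattice gauge theories. II*, Commun. Math.
Phys. **96** (1984) 223–250 [Balaban1984PropagatorsII], Lemma 2.1 (2.61) p. 234, p. 235; *Renormalization group approach
to lattice gauge field theories. I*, Commun. Math. Phys. **109** (1987) 249–301 [Balaban1987RG1], p. 282; *The
variational problem …*, Commun. Math. Phys. **102** (1985) 277–309 [Balaban1985Variational], (190) p. 308.
Unit b2b-balaban-beta-an4 gen 90 (BINDER row D4 OWNER), cell pub-balaban.
-/

namespace Literature.MathematicalPhysics.QuantumFieldTheory.Balaban1983to89.Beta.RemainderRowSum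

open Literature.MathematicalPhysics.QuantumFieldTheory.Balaban1983to89
open Literature.MathematicalPhysics.QuantumFieldTheory.Balaban1983to89.B11SectG (RowSum rowSum_iff_ineq261)
open Literature.MathematicalPhysics.QuantumFieldTheory.Balaban1983to89.B6RandomWalk (Ineq261)
open Literature.MathematicalPhysics.QuantumFieldTheory.Balaban1983to89.B6Lemma21Repaired (Ineq261With)
open Literature.MathematicalPhysics.QuantumFieldTheory.Balaban1983to89.B6Lemma21TwoScale (c1TwoScale)
open Literature.MathematicalPhysics.QuantumFieldTheory.Balaban1983to89.B6Prop22OneScaleTorus (oneScaleGeo)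
open Literature.MathematicalPhysics.QuantumFieldTheory.Balaban1983to89.B6Lemma21TowerTorus (ineq261_oneScaleGeo)
open Literature.MathematicalPhysics.QuantumFieldTheory.Balaban1983to89.B6MultiLevelBoxOperator (Domains)
open Literature.MathematicalPhysics.QuantumFieldTheory.Balaban1983to89.B6Lemma21R0MultiLevelBox
  (geomR0 lemma21R0_multiLevelBox')
open Literature.MathematicalPhysics.QuantumFieldTheory.Balaban1983to89.Beta.RemainderDecay190 (Consts190)

/-! ## §1  (2.61) with any constant IS the row sum; monotonicity in the constant -/

/-- (2.61) with an arbitrary constant `c` at `(α, δ₀)` IS the row sum `RowSum g (αδ₀) c` (the two Props have the same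
body). [cite: Balaban1984PropagatorsII, Lemma 2.1 (2.61) p.234] -/
theorem rowSum_of_ineq261With {g : B6.Geometry} {c δ₀ α : ℝ} (h : Ineq261With c g δ₀ α) : RowSum g (α * δ₀) c := h

/-- The printed (2.61) (`B6RandomWalk.Ineq261`, constant `c₁(α) = B6.c1 d δ₀ α`) IS the row sum at `σ = αδ₀` with
`c = c₁(α)` (`B11SectG.rowSum_iff_ineq261`). [cite: Balaban1984PropagatorsII, Lemma 2.1 (2.61) p.234] -/
theorem rowSum_of_ineq261 {d : ℕ} {g : B6.Geometry} {δ₀ α : ℝ} (h : Ineq261 d g δ₀ α) :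
    RowSum g (α * δ₀) (B6.c1 d δ₀ α) :=
  (rowSum_iff_ineq261 d g δ₀ α).mp h

/-- A row sum with constant `c` is a row sum with any larger constant. [cite: Balaban1984PropagatorsII, (2.61) p.234; bookkeeping] -/
theorem rowSum_mono_const {g : B6.Geometry} {σ c c' : ℝ} (h : RowSum g σ c) (hc : c ≤ c') : RowSum g σ c' :=
  fun y => (h y).trans hc

/-- ONE larger constant serves a whole FAMILY of geometries whose members satisfy (2.61) with a common constant — the
shape of `Data190.hrow`. [cite: Balaban1984PropagatorsII, (2.61) p.234; Balaban1987RG1, p.282; bookkeeping] -/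
theorem rowSum_family_mono_const {ι : Type*} (gn : ι → B6.Geometry) {σ c cR : ℝ}
    (h : ∀ n, RowSum (gn n) σ c) (hc : c ≤ cR) : ∀ n, RowSum (gn n) σ cR :=
  fun n => rowSum_mono_const (h n) hc

/-! ## §2  The one-scale torus family: (2.61) with the printed `c₁(α)`, no side condition, uniformly in the volume -/

section OneScale

/-- **(2.61) on the one-scale torus `T₁^{(K)}` of the tower carriers `P`** (sites `2L^m` per direction, d(y,y′) = periodic
ℓ¹ distance; block data `Mb`, `R` are carried, not used): `Σ_{y′} e^{−αδ₀ d(y,y′)} ≤ c₁(α) = 12c₀(½α)^d` for every y, every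
`α, δ₀` with `αδ₀ > 0` — the row sum at rate `αδ₀` with the printed constant, for every volume exponent `P.m`.
[cite: Balaban1984PropagatorsII, Lemma 2.1 (2.61) p.234; p.235] -/
theorem rowSum_oneScaleGeo (P : Params) {d : ℕ} (hPd : P.d = d) (Mb R : ℕ) {δ₀ α : ℝ} (h : 0 < α * δ₀) :
    RowSum (oneScaleGeo P Mb R) (α * δ₀) (B6.c1 d δ₀ α) :=
  rowSum_of_ineq261 (ineq261_oneScaleGeo P hPd Mb R h)

/-- The same at an arbitrary rate `σ > 0` (read `α := σ∕δ₀`): `RowSum (oneScaleGeo P Mb R) σ (c₁(σ∕δ₀))`.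
[cite: Balaban1984PropagatorsII, Lemma 2.1 (2.61) p.234; p.235] -/
theorem rowSum_oneScaleGeo_rate (P : Params) {d : ℕ} (hPd : P.d = d) (Mb R : ℕ) {δ₀ σ : ℝ} (hδ₀ : 0 < δ₀)
    (hσ : 0 < σ) : RowSum (oneScaleGeo P Mb R) σ (B6.c1 d δ₀ (σ / δ₀)) := by
  have hασ : σ / δ₀ * δ₀ = σ := div_mul_cancel₀ σ hδ₀.ne'
  have h : 0 < σ / δ₀ * δ₀ := by rw [hασ]; exact hσ
  have h261 := rowSum_oneScaleGeo P hPd Mb R h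
  rwa [hασ] at h261

/-- **`Data190.hrow` FOR THE ONE-SCALE TORUS FAMILY** — ONE CONSTANT FOR ALL TORI: for every family `Pn` of tower
parameters of dimension `d` (volumes `(Pn n).m`, numbers of steps `(Pn n).K` arbitrary), every block data `Mb n`, `R n`,
every `δ₀ > 0`, every rate `σ > 0` and every `cR ≥ c₁(σ∕δ₀)`: `∀ n, RowSum (oneScaleGeo (Pn n) (Mb n) (R n)) σ cR`.
[cite: Balaban1984PropagatorsII, Lemma 2.1 (2.61) p.234, p.235; Balaban1987RG1, p.282] -/
theorem hrow_oneScaleGeo {ι : Type*} (Pn : ι → Params) {d : ℕ} (hPd : ∀ n, (Pn n).d = d) (Mb R : ι → ℕ)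
    {δ₀ σ cR : ℝ} (hδ₀ : 0 < δ₀) (hσ : 0 < σ) (hcR : B6.c1 d δ₀ (σ / δ₀) ≤ cR) :
    ∀ n, RowSum (oneScaleGeo (Pn n) (Mb n) (R n)) σ cR :=
  rowSum_family_mono_const (fun n => oneScaleGeo (Pn n) (Mb n) (R n))
    (fun n => rowSum_oneScaleGeo_rate (Pn n) (hPd n) (Mb n) (R n) hδ₀ hσ) hcR

end OneScale

/-! ## §3  The genuine k-level box family: (2.61) with the d-only repaired `c₁″` under print's (2.59) -/

section MultiLevel

variable {d : ℕ}

/-- **(2.61″) on the genuine k-level box family** (`geomR0 D`: the blocks 𝔅 of a nested family `D` (2.1)–(2.2) on the box,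
print's distance (2.46) read literally): for `ℓ, M_h, R ≥ 1` (`L = ℓ + 1`), all box sides `P μ ≥ 1`, every `δ₀ > 0`, every
`0 < α < 1` with (2.59) `¼αδ₀·R·(L·M_h) > 2(d+1) log c₀(½α) + 1`: `Σ_{y′∈𝔅} e^{−αδ₀d(y,y′)} ≤ c₁″ = c1TwoScale (d+1) δ₀ α`
for every y — the row sum at rate `αδ₀`, uniformly in `k`, the volume and the family.
[cite: Balaban1984PropagatorsII, Lemma 2.1 (2.61) p.234, (2.59) p.233, (2.46) p.231; corrected] -/
theorem rowSum_geomR0 {ℓ Mh k R : ℕ} {P : Fin (d + 1) → ℕ} (D : Domains d ℓ Mh k P R) (hℓ : 1 ≤ ℓ) (hMh : 1 ≤ Mh)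
    (hR : 1 ≤ R) (hP : ∀ μ, 1 ≤ P μ) {δ₀ α : ℝ} (hδ : 0 < δ₀) (hα0 : 0 < α) (hα1 : α < 1)
    (h259 : B6.Cond259 (d + 1) δ₀ α R (((ℓ : ℝ) + 1) * Mh)) :
    RowSum (geomR0 D) (α * δ₀) (c1TwoScale (d + 1) δ₀ α) :=
  rowSum_of_ineq261With (lemma21R0_multiLevelBox' D hℓ hMh hR hP hδ hα0 hα1 h259).2.1

/-- **`Data190.hrow` FOR THE GENUINE k-LEVEL BOX FAMILY** — ONE CONDITION, ONE CONSTANT FOR ALL MEMBERS: for every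
family `Dn n : Domains d ℓ M_h (kn n) (Pn n) R` with COMMON `ℓ, M_h, R ≥ 1` and arbitrary numbers of levels `kn n` and
volumes `Pn n` (sides `≥ 1`), every `δ₀ > 0`, `0 < α < 1` with (2.59) for `R` and `M = L·M_h`, and every `cR ≥ c₁″`:
`∀ n, RowSum (geomR0 (Dn n)) (αδ₀) cR`. [cite: Balaban1984PropagatorsII, Lemma 2.1 (2.61) p.234, (2.59) p.233; Balaban1987RG1, p.282; corrected] -/
theorem hrow_geomR0 {ι : Type*} {ℓ Mh R : ℕ} (kn : ι → ℕ) (Pn : ι → Fin (d + 1) → ℕ)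
    (Dn : (n : ι) → Domains d ℓ Mh (kn n) (Pn n) R) (hℓ : 1 ≤ ℓ) (hMh : 1 ≤ Mh) (hR : 1 ≤ R)
    (hP : ∀ n μ, 1 ≤ Pn n μ) {δ₀ α cR : ℝ} (hδ : 0 < δ₀) (hα0 : 0 < α) (hα1 : α < 1)
    (h259 : B6.Cond259 (d + 1) δ₀ α R (((ℓ : ℝ) + 1) * Mh)) (hcR : c1TwoScale (d + 1) δ₀ α ≤ cR) :
    ∀ n, RowSum (geomR0 (Dn n)) (α * δ₀) cR :=
  rowSum_family_mono_const (fun n => geomR0 (Dn n))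
    (fun n => rowSum_geomR0 (Dn n) hℓ hMh hR (hP n) hδ hα0 hα1 h259) hcR

end MultiLevel

/-! ## §4  The field's TYPE verbatim in the chain's currency `q : Consts190` -/

section Field

/-- **THE TYPE OF `Data190.hrow` (`∀ n, RowSum (gn n) q.σ q.cR`) for `gn := fun n => oneScaleGeo (Pn n) (Mb n) (R n)`**,
from the volume-, scale- and history-uniform constants `q` of the chain: it suffices that `q.σ > 0` and
`q.cR ≥ c₁(q.σ∕δ₀)` for some `δ₀ > 0`. [cite: Balaban1987RG1, p.282; Balaban1984PropagatorsII, Lemma 2.1 (2.61) p.234] -/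
theorem hrow_field_oneScaleGeo (q : Consts190) (Pn : ℕ → Params) {d : ℕ} (hPd : ∀ n, (Pn n).d = d) (Mb R : ℕ → ℕ)
    {δ₀ : ℝ} (hδ₀ : 0 < δ₀) (hσ : 0 < q.σ) (hcR : B6.c1 d δ₀ (q.σ / δ₀) ≤ q.cR) :
    ∀ n, RowSum ((fun n => oneScaleGeo (Pn n) (Mb n) (R n)) n) q.σ q.cR :=
  hrow_oneScaleGeo Pn hPd Mb R hδ₀ hσ hcR

/-- **THE TYPE OF `Data190.hrow` for `gn := fun n => geomR0 (Dn n)`** (genuine k-level box family with common `ℓ, M_h, R`):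
it suffices that `q.σ = αδ₀` with `0 < α < 1`, `δ₀ > 0`, (2.59), and `q.cR ≥ c₁″`.
[cite: Balaban1987RG1, p.282; Balaban1984PropagatorsII, Lemma 2.1 (2.61) p.234, (2.59) p.233; corrected] -/
theorem hrow_field_geomR0 (q : Consts190) {d ℓ Mh R : ℕ} (kn : ℕ → ℕ) (Pn : ℕ → Fin (d + 1) → ℕ)
    (Dn : (n : ℕ) → Domains d ℓ Mh (kn n) (Pn n) R) (hℓ : 1 ≤ ℓ) (hMh : 1 ≤ Mh) (hR : 1 ≤ R)
    (hP : ∀ n μ, 1 ≤ Pn n μ) {δ₀ α : ℝ} (hδ : 0 < δ₀) (hα0 : 0 < α) (hα1 : α < 1)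
    (h259 : B6.Cond259 (d + 1) δ₀ α R (((ℓ : ℝ) + 1) * Mh)) (hσ : q.σ = α * δ₀)
    (hcR : c1TwoScale (d + 1) δ₀ α ≤ q.cR) :
    ∀ n, RowSum ((fun n => geomR0 (Dn n)) n) q.σ q.cR := by
  rw [hσ]
  exact hrow_geomR0 kn Pn Dn hℓ hMh hR hP hδ hα0 hα1 h259 hcR

end Field


/-! ## §5  (v1.1) The one-scale SITE-torus family `toB6 (torusGeom Nf η L M) R H` — the carrier `UT Nf` of the NODE-O
walk objects (`B13JointWalkExpansion` ∕ `B13TermWalkData.TermKernels`): (2.61) with `c₀(α)^d ≤ c₁(α)`, no condition -/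

section SiteTorus

open Literature.MathematicalPhysics.QuantumFieldTheory.Balaban1983to89.B9Thm34Ext (toB6)
open Literature.MathematicalPhysics.QuantumFieldTheory.Balaban1983to89.B9Thm37GlueTorus (torusGeom tdist1 torusSum_tdist1_le)
open Literature.MathematicalPhysics.QuantumFieldTheory.Balaban1983to89.B5TorusCover (UT)
open Literature.MathematicalPhysics.QuantumFieldTheory.Balaban1983to89.B6Lemma21OneScaleTorus (c0_le_c0_half)

variable {d : ℕ}

/-- **(2.61) on the one-scale site torus `UT Nf`** in the `toB6` repackaging of the model geometry `torusGeom Nf η L M`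
(every site of scale 0, d(y,y′) = the periodic ℓ¹ distance `tdist1`; `η, L, M, R, H` carried, not used):
`Σ_{y′} e^{−αδ₀ d(y,y′)} ≤ c₀(α)^d` for every y and every `αδ₀ > 0`, uniformly in the torus sizes `Nf` — the lattice
sum `B9Thm37GlueTorus.torusSum_tdist1_le` BY NAME (the same lemma the gaps cell's one-step local kernel families use
for their start-site sum). [cite: Balaban1984PropagatorsII, Lemma 2.1 (2.61) p.234, count p.233; p.235] -/
theorem rowSum_torusGeom (Nf : Fin d → ℕ) [∀ i, NeZero (Nf i)] (η L M R : ℝ) (H : Prop) {δ₀ α : ℝ}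
    (h : 0 < α * δ₀) : RowSum (toB6 (torusGeom Nf η L M) R H) (α * δ₀) (B6.c0 δ₀ α ^ d) := by
  intro y
  show ∑ y' : UT Nf, Real.exp (-(α * δ₀ * tdist1 Nf y y')) ≤ _
  exact torusSum_tdist1_le y h

/-- The same with the PRINTED constant `c₁(α) = 12c₀(½α)^d ≥ c₀(α)^d`.
[cite: Balaban1984PropagatorsII, Lemma 2.1 (2.61) p.234] -/
theorem rowSum_torusGeom_c1 (Nf : Fin d → ℕ) [∀ i, NeZero (Nf i)] (η L M R : ℝ) (H : Prop) {δ₀ α : ℝ}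
    (h : 0 < α * δ₀) : RowSum (toB6 (torusGeom Nf η L M) R H) (α * δ₀) (B6.c1 d δ₀ α) := by
  refine rowSum_mono_const (rowSum_torusGeom Nf η L M R H h) ?_
  have hc : 0 ≤ B6.c0 δ₀ α := by unfold B6.c0; exact tsum_nonneg fun z => (Real.exp_pos _).le
  have hc2 : 0 ≤ B6.c0 δ₀ (α / 2) := by unfold B6.c0; exact tsum_nonneg fun z => (Real.exp_pos _).le
  calc B6.c0 δ₀ α ^ d ≤ B6.c0 δ₀ (α / 2) ^ d := pow_le_pow_left₀ hc (c0_le_c0_half h) _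
    _ ≤ 12 * B6.c0 δ₀ (α / 2) ^ d := le_mul_of_one_le_left (pow_nonneg hc2 _) (by norm_num)
    _ = B6.c1 d δ₀ α := rfl

/-- **`Data190.hrow` FOR THE SITE-TORUS FAMILY** — ONE CONSTANT FOR ALL TORI: for every family of torus sizes `Nf n`
(dimension d), every `η n, L n, M n, R n, H n`, every `δ₀ > 0`, rate `σ > 0` and every `cR ≥ c₀(σ∕δ₀)^d`:
`∀ n, RowSum (toB6 (torusGeom (Nf n) (η n) (L n) (M n)) (R n) (H n)) σ cR`.
[cite: Balaban1984PropagatorsII, Lemma 2.1 (2.61) p.234, p.235; Balaban1987RG1, p.282] -/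
theorem hrow_torusGeom {ι : Type*} (Nf : ι → Fin d → ℕ) [∀ n i, NeZero (Nf n i)] (η L M R : ι → ℝ)
    (H : ι → Prop) {δ₀ σ cR : ℝ} (hδ₀ : 0 < δ₀) (hσ : 0 < σ) (hcR : B6.c0 δ₀ (σ / δ₀) ^ d ≤ cR) :
    ∀ n, RowSum (toB6 (torusGeom (Nf n) (η n) (L n) (M n)) (R n) (H n)) σ cR := by
  have hασ : σ / δ₀ * δ₀ = σ := div_mul_cancel₀ σ hδ₀.ne'
  have h : 0 < σ / δ₀ * δ₀ := by rw [hασ]; exact hσ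
  refine rowSum_family_mono_const (fun n => toB6 (torusGeom (Nf n) (η n) (L n) (M n)) (R n) (H n)) ?_ hcR
  intro n
  have h261 := rowSum_torusGeom (Nf n) (η n) (L n) (M n) (R n) (H n) h
  rwa [hασ] at h261

/-- **THE TYPE OF `Data190.hrow` for `gn := fun n => toB6 (torusGeom (Nf n) (η n) (L n) (M n)) (R n) (H n)`**, in the
chain's currency `q : Consts190`: it suffices that `q.σ > 0` and `q.cR ≥ c₀(q.σ∕δ₀)^d` for some `δ₀ > 0`.
[cite: Balaban1987RG1, p.282; Balaban1984PropagatorsII, Lemma 2.1 (2.61) p.234] -/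
theorem hrow_field_torusGeom (q : Consts190) (Nf : ℕ → Fin d → ℕ) [∀ n i, NeZero (Nf n i)] (η L M R : ℕ → ℝ)
    (H : ℕ → Prop) {δ₀ : ℝ} (hδ₀ : 0 < δ₀) (hσ : 0 < q.σ) (hcR : B6.c0 δ₀ (q.σ / δ₀) ^ d ≤ q.cR) :
    ∀ n, RowSum ((fun n => toB6 (torusGeom (Nf n) (η n) (L n) (M n)) (R n) (H n)) n) q.σ q.cR :=
  hrow_torusGeom Nf η L M R H hδ₀ hσ hcR

end SiteTorus

end Literature.MathematicalPhysics.QuantumFieldTheory.Balaban1983to89.Beta.RemainderRowSum
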